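import Summits.QuantumFields.BalabanUV.T4Continuum.Support.NE9CurChartOneInstanceUniformBall
import Literature.MathematicalPhysics.QuantumFieldTheory.Balaban1983to89.B9Eq3126H1BoundGaugeOrbit

/-!
# NE9CurChartOneInstanceGaugeOrbit — THE ONE-INSTANCE CHART OF `cur V` (`W80` in the W-slot, the J-79 term in the linear slot) ON ONE PAIR OF BALLS
# FOR EVERY `V = U^g` IN THE GAUGE ORBIT OF THE SMALL-FIELD SET OF A FIXED LATTICE: ne9-leaf-05's `Support/NE9CurChartOneInstanceUniformBall` §1
# carried along the orbit by [Balaban1985BackgroundPropagators] (3.34) typed on the chain's carriers (NE9 leaf-03 gen 60: `B9Eq328GaugeAction` …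
# `B9Eq3126H1BoundGaugeOrbit`); cell `pub-balaban`, T4-DAG §2 node U3 ∕ §6 NE9, route R2′; Summits-side NEW leaf under this seat's INTERFACE REQUEST
# NE9 (ruling e34b3e0c (0) — requested: `NE9CurChartOneInstanceGaugeOrbit.cur_chart_exists_oneInstance_gaugeOrbit_smallField`; a separate file because
# the host leaf is ne9-leaf-05's and at 380 l.), nothing printed asserted

HONEST FRAMING (T4-DAG PAGE 1).  Rung (B)+1 of the FINITE-VOLUME T⁴ programme — NOT infinite volume, NOT a mass gap, NOT the Clay problem.  NE9
(`T4OutputRate.NE9` ∧ `FadingMemory`) is a cell NEW ESTIMATE, NOT PRINTED in [I] = [Balaban1987RG1] (CMP **109**), [II] = [Balaban1988RG2Cluster]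
(CMP **116**), and NOT PROVED here («NE9 ⇐ the named binders»; spine PROVED 0∕9).  HONEST DEPENDENCY (cell line, verbatim): continuum YM on T⁴ ⇐
BetaPertH ∧ nine spine estimates (0/9 proved); BetaPertH ⇐ (D1) ∧ (D4) ∧ CAP+tail; G-an2-4 gates asym, D1 and NE2/3/4.  The `cur U` OBJECT is ONE
item of the MODEL O-NE9-1 (species (a) data); the END's `act` ∕ `ker` halves and NEEDS-COORDINATOR #5 are untouched.

WHAT THIS FILE PROVES (THREE theorems = the host's §1–§3 on the orbit; 0 def, 0 sorry, axioms standard).  **`cur_chart_exists_oneInstance_gaugeOrbit_smallField`**: the host's §1 numbers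
`ε₃ C_H C_G a_C ε_C` (∃, U-free) and, for all displayed `C₄ ≥ 0`, `0 < a₃ ≤ a_C`, `0 ≤ θ̄ < 1`, radii `ε₄ R_b R′ > 0` such that for EVERY background `U`
of E162's data with `‖U(b) − 1‖ ≤ ε ≤ ε₃` and `hRS`, EVERY gauge function `g` (`g(x) ∈ U1` unitary, `τ`-central, fibrewise isometric), ANY regularity
witnesses `hU1′ hreg′` of `U^g`, and all (L3) letters `ρ`, `τc`, `J`, `Δπ` (the latter on the (115)-carrier AT `∇_{U^g}`): `hpos′(U^g)` HOLDS and — at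
`H(U^g)`, `𝔊(U^g)`, `C(U^g)` — `‖H(U^g)‖ ≤ C_H ∧ ‖𝔊(U^g)‖ ≤ C_G ∧ Regime H(U^g) 0 C(U^g) C_H 0 C₂ c₄ 0 a_C ε_C` and, whenever the W-slot's (98) bound
and `‖𝔊(U^g) ∘L L_J‖ ≤ θ̄` hold, (Ψ1)–(Ψ3) for the one-instance chart of `cur (U^g)` on `ball 0 R_b → ball 0 R′`; §2 **`…_W80`** (the W-slot's
`(C₄, a₃)` PRODUCED, V₀-slot and currents read at `U^g`) and §3 **`…_smallJ`** (the display-free face: `‖J‖ ≤ j₁`, `‖Δπ‖ ≤ M_Δ` ⇒ `hpos′ ∧ QuadAnalytic ∧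
‖𝔊(U^g) ∘L L_J‖ ≤ ½ ∧ (Ψ1)–(Ψ3)`) exactly as the host's §2/§3.  MECHANISM: the host proof
verbatim; the background enters ONLY through `hpos` (transferred: `B9Eq334LaplaceACovariance.hpos_gaugeU`), the operator norms of `H`, `𝔊` in
`NegSize → Space115 … (∇_·)` (GAUGE-INVARIANT: `B11Eq117GaugeNormInvariance` on `B11Eq115GaugeIsometry.gauge115Isometry`, so (K)'s bounds hold at
`U^g`: `B9Eq3126H1BoundGaugeOrbit`), and U-generic letters applied at `U^g` with its own witnesses (`sectC_regime_uniform_opNorm`, `prop4Hyp_Cc`,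
`analyticOnNhd_Cc`, `analyticOnNhd_W80_lt`, `QtorusW_surjective`).
DISGUISE TEST: composition of landed theorems + the host's real arithmetic; no inequality of the series proved; per-LATTICE numbers — NOT print's
uniformity in the LATTICE, NOT (73)∕(97)'s «d and L only», NOT p. 416's per-cube locality reduction (Thms 3.1–3.10: the orbit here is that of the
one-cube torus); the Λ-road is ONE of T23's two placements; not NE9.
References (TYPES ∕ loci only): [Balaban1985Variational] (45)–(47) p. 285, (79)–(80) p. 290, Prop. 4 (97)–(98) pp. 292–293, Prop. 6 (117)–(121)
p. 295, (172)–(175) p. 305; [Balaban1985BackgroundPropagators] (3.26) p. 395, (3.28)–(3.35) pp. 395–396, Thm 3.11 p. 416, (3.126) p. 420, (3.153) p. 426.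
Imports the host leaf `Support/NE9CurChartOneInstanceUniformBall` and `B9Eq3126H1BoundGaugeOrbit` ONLY; modifies nothing; no END re-wired.  Value =
route R2′ bookkeeping at rung (B)+1 (the species' chart on the GAUGE ORBIT of the small-field set), NOT summit progress.
-/

noncomputable section

open Metric Set
open scoped InnerProductSpace

namespace Summit.QuantumFields.BalabanUV.T4Continuum.NE9CurChartOneInstanceGaugeOrbit

open Literature.MathematicalPhysics.QuantumFieldTheory.Balaban1983to89
open B11Eq103H1Complex B11Eq115Space B11Eq174Chart
open B11Eq111FrakG (nabla115)
open B13Contraction113 (QuadAnalytic)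
open B11Prop6Scheme (Prop4Hyp)
open B9Eq319QprimeTorus (fineP)
open B9SectCLatticeCarrier (Bond)
open B4Sect5Torus (TSite)
open B7Prop1Explicit (U1 Wcx boxVec)
open B9Eq315QTorus (perCfg cornerSite QtorusW laplaceAofBackground)
open B9Eq315QTorusOnto (QtorusW_surjective)
open B9Eq310HessianOperator (adTransportW)
open B9Thm311SmallFieldClosed (laplaceAofBackground_pos_of_small_field)
open B9Eq3126H1BoundGaugeOrbit (exists_H1_frakG_CLM_bound_of_gaugeOrbit_small_field)
open B9Eq334LaplaceACovariance (hpos_gaugeU)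
open B9Eq328GaugeAction (gaugeU AdA AdW)
open B11Eq118RegimeRadiiUniform (sectC_regime_uniform_opNorm radius_pos radius_contr)
open B11Eq143LinearTermRadiiUniform (regime_linear_explicit min3_pos radiiLinear_add_le)
open B11Eq44COperatorTorus (Cc analyticOnNhd_Cc prop4Hyp_Cc)
open B11Eq80Current (W80 analyticOnNhd_W80_lt)
open B11Eq79LinearTerm (LJ)
open B11Eq63V0GroupCurrent (curV0)
open B9Eq315QTorusOnto (liftSite perSite_liftSite)
open B11Eq117TransformationNorm (norm_nabla115_le)
open B11Ineq73KernelLettersUniform (exists_quadAnalytic_W80_uniform)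
open B11Eq79LinearTermUniform (exists_norm_LJ_le_uniform)
open Summit.QuantumFields.BalabanUV.T4Continuum.NE9B11ChartAnalytic (chartHB_triple_of_twoRegimes)

set_option maxRecDepth 8192 in
/-- **THE ONE-INSTANCE CHART OF `cur V` ON ONE PAIR OF BALLS FOR EVERY `V = U^g` IN THE GAUGE ORBIT OF THE SMALL-FIELD SET, MODULO THE SAME TWO
DISPLAYED UNIFORM LETTERS** — the host leaf's §1 `cur_chart_exists_oneInstance_smallField_uniform` (ne9-leaf-05 gen 68) with the background of the
CONCLUSION replaced by `gaugeU g U` (`g(x) ∈ U1` unitary, `τ`-central, fibrewise isometric; the regularity witnesses `hU1′ hreg′` of `U^g` displayed at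
the same `α` — supplied in general by `B9Eq333ProjectionCovariance.hU1_gaugeU/hreg_gaugeU`): the SAME numbers `ε₃ C_H C_G a_C ε_C` and `ε₄ R_b R′`,
`hpos′(U^g)` PRODUCED ([Balaban1985BackgroundPropagators] Thm 3.11 transferred by (3.34), `B9Eq334LaplaceACovariance.hpos_gaugeU`), the letters'
bounds `‖H(U^g)‖ ≤ C_H`, `‖𝔊(U^g)‖ ≤ C_G` (gauge-INVARIANT operator norms, `B9Eq3126H1BoundGaugeOrbit`), the Sect. C regime and (Ψ1)–(Ψ3) at `∇_{U^g}`
exactly as in the host proof (`sectC_regime_uniform_opNorm`, `prop4Hyp_Cc`, `analyticOnNhd_W80_lt`, `regime_linear_explicit`,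
`chartHB_triple_of_twoRegimes` — all U-generic, applied at `U^g` with its own witnesses). [folklore] -/
theorem cur_chart_exists_oneInstance_gaugeOrbit_smallField {d : ℕ} (L : ℕ) [NeZero L] (m : Fin d → ℕ) [∀ i, NeZero (fineP L m i)]
    (hL : 1 ≤ L)
    {𝔸 : Type*} [NormedRing 𝔸] [NormedAlgebra ℂ 𝔸] [CompleteSpace 𝔸] [NormOneClass 𝔸] [StarRing 𝔸] [NormedStarGroup 𝔸] [StarModule ℂ 𝔸]
    [FiniteDimensional ℂ 𝔸]
    {W : Type*} [NormedAddCommGroup W] [InnerProductSpace ℂ W] [FiniteDimensional ℂ W] (φ : W ≃ₗ[ℂ] 𝔸) {Mφ Mφ' : ℝ} (hMφ : 0 ≤ Mφ)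
    (hMφ' : 0 ≤ Mφ') (hφ : ∀ w, ‖φ w‖ ≤ Mφ * ‖w‖) (hφ' : ∀ X, ‖φ.symm X‖ ≤ Mφ' * ‖X‖)
    (τ : 𝔸 →ₗ[ℂ] ℂ) {Cτ : ℝ} (hτ : ∀ X, ‖τ X‖ ≤ Cτ * ‖X‖) (hCτ : 0 ≤ Cτ)
    {η : ℝ} [Fact (0 < (L : ℝ))] [Fact (0 < η)] {lev₀ : Bond d (fineP L m) → ℕ} {levB : Bond d m → ℕ} (lev₁ : Bond d (fineP L m) × Fin d → ℕ)
    (hlev : ∀ b, 1 ≤ lev₀ b) {c₀ c₁ : ℝ} [Fact (0 < c₀)] [Fact (0 < c₁)] {a : ℝ} (ha : 0 < a) :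
    ∃ ε₃ CH CG aC εC : ℝ, 0 < ε₃ ∧ 0 < CH ∧ 0 < CG ∧ 0 < aC ∧ 0 < εC ∧
      4 * CH * (2097152 * ((d : ℝ) + 1) ^ 2) * (εC + aC) < 1 ∧ 2 * (εC + aC) ≤ 1 / (512 * ((d : ℝ) + 1)) ∧
      ∀ {C₄ a₃ θ : ℝ}, 0 ≤ C₄ → 0 < a₃ → a₃ ≤ aC → 0 ≤ θ → θ < 1 →
      ∃ ε₄ Rb R' : ℝ, 0 < ε₄ ∧ 0 < Rb ∧ 0 < R' ∧
      ∀ (U : Bond d (fineP L m) → 𝔸ˣ) {α : ℝ} (hα : α ≤ 1 / 128) (hα1 : α ≤ 1 / 64)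
        (hU1 : ∀ (x : B7Prop1Explicit.Site d) (κ : Fin d), perCfg (fineP L m) U x κ ∈ U1 𝔸)
        (hreg : ∀ (y : TSite d m) (κ : Fin d) (r : Fin d → Fin L),
          ‖((Wcx L (perCfg (fineP L m) U) (cornerSite L y) κ (boxVec L r) : 𝔸ˣ) : 𝔸) - 1‖ ≤ α)
        (hαL : 50 * (d + 1) * α * (L : ℝ) ^ d ≤ 1 / 2) {ε : ℝ}, 0 ≤ ε → ε ≤ ε₃ → (∀ b, ‖(U b : 𝔸) - 1‖ ≤ ε) →
        (∀ (b : Bond d (fineP L m)) (v u : W), inner ℂ (adTransportW φ U b v) u = inner ℂ v (adTransportW φ (fun b => (U b)⁻¹) b u)) →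
      ∀ {g : TSite d (fineP L m) → 𝔸ˣ}, (∀ x, g x ∈ U1 𝔸) → (∀ x, star (g x : 𝔸) = ((g x)⁻¹ : 𝔸ˣ)) →
        (∀ (x : TSite d (fineP L m)) (X : 𝔸), τ (AdA (g x) X) = τ X) →
        (∀ (x : TSite d (fineP L m)) (v v' : W), inner ℂ (AdW φ (g x) v) (AdW φ (g x) v') = inner ℂ v v') →
      ∀ (hU1' : ∀ (x : B7Prop1Explicit.Site d) (κ : Fin d), perCfg (fineP L m) (gaugeU g U) x κ ∈ U1 𝔸)
        (hreg' : ∀ (y : TSite d m) (κ : Fin d) (r : Fin d → Fin L),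
          ‖((Wcx L (perCfg (fineP L m) (gaugeU g U)) (cornerSite L y) κ (boxVec L r) : 𝔸ˣ) : 𝔸) - 1‖ ≤ α),
      ∀ (ρ : (𝔸 →L[ℂ] ℂ) →L[ℂ] 𝔸) (τc : 𝔸 →L[ℂ] ℂ)
        (J : NegSize (L : ℝ) η lev₀ 3 𝔸) (Δπ : Space115 (L : ℝ) η lev₀ lev₁ (nabla115 η (gaugeU g U)) →L[ℂ] NegSize (L : ℝ) η lev₀ 3 𝔸),
      ∃ hpos : ∀ x : BondL2K ℂ d (fineP L m) c₀ W, x ≠ 0 →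
          0 < RCLike.re (inner ℂ x (laplaceAofBackground L m hL φ (gaugeU g U) hα1 hU1' hreg' τ η (c₀ := c₀) (c₁ := c₁) a x)),
      let Hc := H1LatticeCLM (lev₀ := lev₀) (levB := levB) φ hpos (QtorusW_surjective L m hL (gaugeU g U) hα1 hU1' hreg' hαL φ) lev₁ (nabla115 η (gaugeU g U))
      let Gc := frakGLatticeCLM (lev₀ := lev₀) φ hpos (QtorusW_surjective L m hL (gaugeU g U) hα1 hU1' hreg' hαL φ) lev₁ (nabla115 η (gaugeU g U))
      let Cx := Cc L m η (gaugeU g U) lev₀ lev₁ (nabla115 η (gaugeU g U)) levB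
      ‖Hc‖ ≤ CH ∧ ‖Gc‖ ≤ CG ∧
      Regime Hc 0 Cx CH 0 (2097152 * ((d : ℝ) + 1) ^ 2) (1 / (512 * ((d : ℝ) + 1))) 0 aC εC ∧
      ((∀ Y : Space115 (L : ℝ) η lev₀ lev₁ (nabla115 η (gaugeU g U)), ‖Y‖ < a₃ → ‖W80 ρ τc (gaugeU g U) Hc Cx εC J Δπ Y‖ ≤ C₄ * ‖Y‖ ^ 2) →
        ‖Gc.comp (LJ ρ τc Hc Cx J)‖ ≤ θ →
        DifferentiableOn ℂ (chartHB Gc (-(Gc.comp (LJ ρ τc Hc Cx J))) (W80 ρ τc (gaugeU g U) Hc Cx εC J Δπ) 0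
            (fun A' => A' + solA Hc 0 Cx 0 εC A') ε₄ Hc) (ball (0 : NegSize (L : ℝ) η levB 0 𝔸) Rb) ∧
        MapsTo (chartHB Gc (-(Gc.comp (LJ ρ τc Hc Cx J))) (W80 ρ τc (gaugeU g U) Hc Cx εC J Δπ) 0
            (fun A' => A' + solA Hc 0 Cx 0 εC A') ε₄ Hc) (ball (0 : NegSize (L : ℝ) η levB 0 𝔸) Rb)
            (ball (0 : Space115 (L : ℝ) η lev₀ lev₁ (nabla115 η (gaugeU g U))) R') ∧
        chartHB Gc (-(Gc.comp (LJ ρ τc Hc Cx J))) (W80 ρ τc (gaugeU g U) Hc Cx εC J Δπ) 0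
            (fun A' => A' + solA Hc 0 Cx 0 εC A') ε₄ Hc 0 = 0) := by
  -- Thm 3.11 at every small field (owner gen 80) and the uniform operator letters (owner gen 81)
  obtain ⟨ε₃, hε₃, Hpos⟩ := laplaceAofBackground_pos_of_small_field L m hL φ (c₀ := c₀) (c₁ := c₁) (ne_of_gt (Fact.out : 0 < η)) ha hMφ
    hMφ' hφ hφ' τ hτ hCτ
  obtain ⟨CH, CG, ε₅, hCH, hCG, hε₅, Hb⟩ :=
    exists_H1_frakG_CLM_bound_of_gaugeOrbit_small_field L m hL φ (c₀ := c₀) (c₁ := c₁) (η := η) lev₀ levB lev₁ ha hMφ hMφ' hφ hφ' τ hτ hCτ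
  -- the T-slot radius `r_C(C_H, d)` of NE9 leaf-01 (closed form; `a_C = ε_C = r_C`)
  obtain ⟨rC, hrC⟩ : ∃ r : ℝ, r = min (1 / (512 * ((d : ℝ) + 1)) / 4)
      (min ((1 : ℝ) / 2) (1 / (16 * (CH * (2097152 * ((d : ℝ) + 1) ^ 2) + 1)))) := ⟨_, rfl⟩
  have hrC0 : 0 < rC := by
    have h := radius_pos (a₃ := 1 / (512 * ((d : ℝ) + 1))) (C₄ := 2097152 * ((d : ℝ) + 1) ^ 2) (δ := 1) hCH.le (by positivity)
      (by positivity) one_pos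
    rw [hrC]; simpa using h
  have hcontrC : 4 * CH * (2097152 * ((d : ℝ) + 1) ^ 2) * (rC + rC) < 1 := by
    have h := radius_contr (a₃ := 1 / (512 * ((d : ℝ) + 1))) (C₄ := 2097152 * ((d : ℝ) + 1) ^ 2) (δ := 1) hCH.le (by positivity)
      (by positivity) one_pos
    rw [hrC]; simpa using h
  have hdomC : 2 * (rC + rC) ≤ 1 / (512 * ((d : ℝ) + 1)) := by
    have h : rC ≤ 1 / (512 * ((d : ℝ) + 1)) / 4 := by rw [hrC]; exact min_le_left _ _
    linarith
  refine ⟨min ε₃ ε₅, CH, CG, rC, rC, lt_min hε₃ hε₅, hCH, hCG, hrC0, hrC0, hcontrC, hdomC, ?_⟩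
  intro C₄ a₃ θ hC₄ ha₃ ha₃C hθ0 hθ1
  -- the Λ-slot radii of (D′) at `(C_G, θ̄, C₄, a₃, δ := r_C)` (closed form)
  obtain ⟨ε₄, hε₄def⟩ : ∃ e : ℝ, e = min (a₃ / 4) (min (rC / 2) ((1 - θ) / (16 * (CG * C₄ + 1)))) := ⟨_, rfl⟩
  obtain ⟨a', ha'def⟩ : ∃ e : ℝ, e = (1 - θ) * ε₄ / (4 * (θ + 1)) := ⟨_, rfl⟩
  have hs : 0 < 1 - θ := by linarith
  have hε₄ : 0 < ε₄ := by rw [hε₄def]; exact min3_pos hCG.le hC₄ ha₃ hθ1 hrC0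
  have ha' : 0 < a' := by rw [ha'def]; positivity
  have hcap : ε₄ + a' ≤ rC := by
    have h := radiiLinear_add_le hCG.le hC₄ ha₃ hθ0 hθ1 hrC0
    rw [ha'def, hε₄def]; exact h
  have hden : 0 < 1 - 4 * CH * (2097152 * ((d : ℝ) + 1) ^ 2) * (rC + rC) := by linarith
  refine ⟨ε₄, a' / (CH + 1), 1 / (1 - 4 * CH * (2097152 * ((d : ℝ) + 1) ^ 2) * (rC + rC)) * (ε₄ + a'), hε₄, by positivity,
    by positivity, ?_⟩
  intro U α hα hα1 hU1 hreg hαL ε hε hεm hUε hRS g hg hstar hτg hAd hU1' hreg' ρ τc J Δπ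
  -- positivity at `U` (owner's (E)), transferred to `U^g` by (3.34)
  have hpos := Hpos U hα1 hU1 hreg hε (hεm.trans (min_le_left _ _)) hUε hRS
  have hpos' : ∀ x : BondL2K ℂ d (fineP L m) c₀ W, x ≠ 0 →
      0 < RCLike.re (inner ℂ x (laplaceAofBackground L m hL φ (gaugeU g U) hα1 hU1' hreg' τ η (c₀ := c₀) (c₁ := c₁) a x)) :=
    hpos_gaugeU L m hL φ U hα1 hU1 hreg hU1' hreg' τ η hτg hstar hAd a hpos
  refine ⟨hpos', ?_⟩
  intro Hc Gc Cx
  obtain ⟨hH, hG⟩ := Hb U hα1 hU1 hreg hε (hεm.trans (min_le_right _ _)) hUε hRS hpos (QtorusW_surjective L m hL U hα1 hU1 hreg hαL φ) hg hstar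
    hτg hAd hU1' hreg' hpos' (QtorusW_surjective L m hL (gaugeU g U) hα1 hU1' hreg' hαL φ)
  -- the Sect. C regime at the uniform bound `C_H` (leaf-01's closed form, read at `r_C`)
  have RC : Regime Hc 0 Cx CH 0 (2097152 * ((d : ℝ) + 1) ^ 2) (1 / (512 * ((d : ℝ) + 1))) 0 rC rC := by
    rw [hrC]; exact sectC_regime_uniform_opNorm L m η lev₀ lev₁ levB hL hα hlev hCH.le (gaugeU g U) hU1' hreg' Hc hH
  refine ⟨hH, hG, RC, fun hW4 hθ => ?_⟩
  -- the letter `C(U^g)`: U-free constants, analytic on its ball (NE9 leaf-03)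
  have hC : Prop4Hyp Cx (2097152 * ((d : ℝ) + 1) ^ 2) (1 / (512 * ((d : ℝ) + 1))) :=
    prop4Hyp_Cc L m η (gaugeU g U) lev₀ lev₁ (nabla115 η (gaugeU g U)) levB hL hα hU1' hreg' hlev
  have hCa : AnalyticOnNhd ℂ Cx {Y | ‖Y‖ < 1 / (512 * ((d : ℝ) + 1))} :=
    analyticOnNhd_Cc L m η (gaugeU g U) lev₀ lev₁ (nabla115 η (gaugeU g U)) levB hL hα hU1' hreg' hlev
  -- the W-slot: `W80` is analytic on `‖Y‖ < a₃ ≤ a_C`; only its (98) VALUE bound is displayed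
  have hWa : AnalyticOnNhd ℂ (W80 ρ τc (gaugeU g U) Hc Cx rC J Δπ) {Y : Space115 (L : ℝ) η lev₀ lev₁ (nabla115 η (gaugeU g U)) | ‖Y‖ < a₃} :=
    analyticOnNhd_W80_lt ρ τc (gaugeU g U) RC hC J Δπ ha₃C
  have hWq : QuadAnalytic (W80 ρ τc (gaugeU g U) Hc Cx rC J Δπ) C₄ a₃ := by
    refine ⟨hW4, fun P Q => ?_⟩
    have hline : Differentiable ℂ (fun ζ : ℂ => P + ζ • Q) := (differentiable_const P).add (differentiable_id.smul_const Q)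
    exact hWa.differentiableOn.comp hline.differentiableOn fun ζ hζ => hζ
  -- the linear slot: `Λ := −(𝔊(U) ∘L L_J)` is `θ̄`-contractive, `𝔊(U)` is `C_G`-bounded
  have hGpt : ∀ f : NegSize (L : ℝ) η lev₀ 3 𝔸, ‖Gc f‖ ≤ CG * ‖f‖ :=
    fun f => (ContinuousLinearMap.le_opNorm _ f).trans (mul_le_mul_of_nonneg_right hG (norm_nonneg f))
  have hΛ : ∀ Y : Space115 (L : ℝ) η lev₀ lev₁ (nabla115 η (gaugeU g U)), ‖(-(Gc.comp (LJ ρ τc Hc Cx J))) Y‖ ≤ θ * ‖Y‖ := fun Y => by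
    rw [_root_.neg_apply, norm_neg]
    exact (ContinuousLinearMap.le_opNorm _ Y).trans (mul_le_mul_of_nonneg_right hθ (norm_nonneg Y))
  have R : Regime Gc (-(Gc.comp (LJ ρ τc Hc Cx J))) (W80 ρ τc (gaugeU g U) Hc Cx rC J Δπ) CG θ C₄ a₃ 0 a' ε₄ := by
    have hj : (0 : ℝ) ≤ (1 - θ) * min (a₃ / 4) (min (rC / 2) ((1 - θ) / (16 * (CG * C₄ + 1)))) / (4 * (CG + 1)) := by
      have := min3_pos hCG.le hC₄ ha₃ hθ1 hrC0
      positivity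
    have h := regime_linear_explicit hCG.le hC₄ ha₃ hθ0 hθ1 hrC0 Gc (-(Gc.comp (LJ ρ τc Hc Cx J))) hGpt hΛ hWq hj
    rw [ha'def, hε₄def]; exact h
  -- the datum ball: `‖H(U) B‖ < a` on `‖B‖ < a∕(C_H + 1)`
  have hRb : ∀ B ∈ ball (0 : NegSize (L : ℝ) η levB 0 𝔸) (a' / (CH + 1)), ‖Hc B‖ < a' := by
    intro B hB
    rw [mem_ball_zero_iff] at hB
    have h1 : ‖Hc B‖ ≤ CH * ‖B‖ := (ContinuousLinearMap.le_opNorm _ B).trans (mul_le_mul_of_nonneg_right hH (norm_nonneg B))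
    have h2 : CH * ‖B‖ ≤ CH * (a' / (CH + 1)) := mul_le_mul_of_nonneg_left hB.le hCH.le
    have h3 : CH * (a' / (CH + 1)) < a' := by
      rw [mul_div_assoc', div_lt_iff₀ (by positivity)]; nlinarith
    linarith
  exact chartHB_triple_of_twoRegimes R hWa le_rfl ha' RC hCa hcap Hc hRb (by positivity) le_rfl

/-! ## §2 On the orbit, the W-slot letter PRODUCED: only `θ̄` displayed -/

set_option maxRecDepth 8192 in
/-- **§2 ON THE GAUGE ORBIT — the W-slot's (98)-constant PRODUCED** (the host's `…_uniform_W80` with the conclusion's background `gaugeU g U`;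
the V₀-slot hypothesis and the currents are read AT `U^g`). Same numbers; §1 of this file + `exists_quadAnalytic_W80_uniform` (U-free letters) +
`norm_nabla115_le` at `U^g` from `hU1′`. [folklore] -/
theorem cur_chart_exists_oneInstance_gaugeOrbit_smallField_W80 {d : ℕ} (L : ℕ) [NeZero L] (m : Fin d → ℕ) [∀ i, NeZero (fineP L m i)]
    (hL : 1 ≤ L)
    {𝔸 : Type*} [NormedRing 𝔸] [NormedAlgebra ℂ 𝔸] [CompleteSpace 𝔸] [NormOneClass 𝔸] [StarRing 𝔸] [NormedStarGroup 𝔸] [StarModule ℂ 𝔸]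
    [FiniteDimensional ℂ 𝔸]
    {W : Type*} [NormedAddCommGroup W] [InnerProductSpace ℂ W] [FiniteDimensional ℂ W] (φ : W ≃ₗ[ℂ] 𝔸) {Mφ Mφ' : ℝ} (hMφ : 0 ≤ Mφ)
    (hMφ' : 0 ≤ Mφ') (hφ : ∀ w, ‖φ w‖ ≤ Mφ * ‖w‖) (hφ' : ∀ X, ‖φ.symm X‖ ≤ Mφ' * ‖X‖)
    (τ : 𝔸 →ₗ[ℂ] ℂ) {Cτ : ℝ} (hτ : ∀ X, ‖τ X‖ ≤ Cτ * ‖X‖) (hCτ : 0 ≤ Cτ)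
    {η : ℝ} [Fact (0 < (L : ℝ))] [Fact (0 < η)] {lev₀ : Bond d (fineP L m) → ℕ} {levB : Bond d m → ℕ} (lev₁ : Bond d (fineP L m) × Fin d → ℕ)
    (hlev : ∀ b, 1 ≤ lev₀ b) {c₀ c₁ : ℝ} [Fact (0 < c₀)] [Fact (0 < c₁)] {a : ℝ} (ha : 0 < a)
    -- the (L3) letters, the V₀-slot letters, the current bounds and the linear slot's contraction — ALL BEFORE `∀ U`
    (ρ : (𝔸 →L[ℂ] ℂ) →L[ℂ] 𝔸) (τc : 𝔸 →L[ℂ] ℂ) {CV RV MJ MΔ θ : ℝ} (hCV : 0 ≤ CV) (hRV : 0 < RV) (hMJ : 0 ≤ MJ) (hMΔ : 0 ≤ MΔ)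
    (hθ0 : 0 ≤ θ) (hθ1 : θ < 1) :
    ∃ ε₃ CH CG aC εC a₃ C₄ ε₄ Rb R' : ℝ, 0 < ε₃ ∧ 0 < CH ∧ 0 < CG ∧ 0 < aC ∧ 0 < εC ∧ 0 < a₃ ∧ 0 ≤ C₄ ∧ 0 < ε₄ ∧ 0 < Rb ∧ 0 < R' ∧
      ∀ (U : Bond d (fineP L m) → 𝔸ˣ) {α : ℝ} (hα : α ≤ 1 / 128) (hα1 : α ≤ 1 / 64)
        (hU1 : ∀ (x : B7Prop1Explicit.Site d) (κ : Fin d), perCfg (fineP L m) U x κ ∈ U1 𝔸)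
        (hreg : ∀ (y : TSite d m) (κ : Fin d) (r : Fin d → Fin L),
          ‖((Wcx L (perCfg (fineP L m) U) (cornerSite L y) κ (boxVec L r) : 𝔸ˣ) : 𝔸) - 1‖ ≤ α)
        (hαL : 50 * (d + 1) * α * (L : ℝ) ^ d ≤ 1 / 2) {ε : ℝ}, 0 ≤ ε → ε ≤ ε₃ → (∀ b, ‖(U b : 𝔸) - 1‖ ≤ ε) →
        (∀ (b : Bond d (fineP L m)) (v u : W), inner ℂ (adTransportW φ U b v) u = inner ℂ v (adTransportW φ (fun b => (U b)⁻¹) b u)) →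
      ∀ {g : TSite d (fineP L m) → 𝔸ˣ}, (∀ x, g x ∈ U1 𝔸) → (∀ x, star (g x : 𝔸) = ((g x)⁻¹ : 𝔸ˣ)) →
        (∀ (x : TSite d (fineP L m)) (X : 𝔸), τ (AdA (g x) X) = τ X) →
        (∀ (x : TSite d (fineP L m)) (v v' : W), inner ℂ (AdW φ (g x) v) (AdW φ (g x) v') = inner ℂ v v') →
      ∀ (hU1' : ∀ (x : B7Prop1Explicit.Site d) (κ : Fin d), perCfg (fineP L m) (gaugeU g U) x κ ∈ U1 𝔸)
        (hreg' : ∀ (y : TSite d m) (κ : Fin d) (r : Fin d → Fin L),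
          ‖((Wcx L (perCfg (fineP L m) (gaugeU g U)) (cornerSite L y) κ (boxVec L r) : 𝔸ˣ) : 𝔸) - 1‖ ≤ α),
        (∀ Y : Space115 (L : ℝ) η lev₀ lev₁ (nabla115 η (gaugeU g U)), ‖Y‖ < RV →
          ‖curV0 (lev₁ := lev₁) (Dc := nabla115 η (gaugeU g U)) ρ τc (gaugeU g U) Y‖ ≤ CV * ‖Y‖ ^ 2) →
      ∀ (J : NegSize (L : ℝ) η lev₀ 3 𝔸) (Δπ : Space115 (L : ℝ) η lev₀ lev₁ (nabla115 η (gaugeU g U)) →L[ℂ] NegSize (L : ℝ) η lev₀ 3 𝔸),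
        ‖J‖ ≤ MJ → ‖Δπ‖ ≤ MΔ →
      ∃ hpos : ∀ x : BondL2K ℂ d (fineP L m) c₀ W, x ≠ 0 →
          0 < RCLike.re (inner ℂ x (laplaceAofBackground L m hL φ (gaugeU g U) hα1 hU1' hreg' τ η (c₀ := c₀) (c₁ := c₁) a x)),
      let Hc := H1LatticeCLM (lev₀ := lev₀) (levB := levB) φ hpos (QtorusW_surjective L m hL (gaugeU g U) hα1 hU1' hreg' hαL φ) lev₁ (nabla115 η (gaugeU g U))
      let Gc := frakGLatticeCLM (lev₀ := lev₀) φ hpos (QtorusW_surjective L m hL (gaugeU g U) hα1 hU1' hreg' hαL φ) lev₁ (nabla115 η (gaugeU g U))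
      let Cx := Cc L m η (gaugeU g U) lev₀ lev₁ (nabla115 η (gaugeU g U)) levB
      ‖Hc‖ ≤ CH ∧ ‖Gc‖ ≤ CG ∧ Regime Hc 0 Cx CH 0 (2097152 * ((d : ℝ) + 1) ^ 2) (1 / (512 * ((d : ℝ) + 1))) 0 aC εC ∧
      QuadAnalytic (W80 ρ τc (gaugeU g U) Hc Cx εC J Δπ) C₄ a₃ ∧
      (‖Gc.comp (LJ ρ τc Hc Cx J)‖ ≤ θ →
        DifferentiableOn ℂ (chartHB Gc (-(Gc.comp (LJ ρ τc Hc Cx J))) (W80 ρ τc (gaugeU g U) Hc Cx εC J Δπ) 0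
            (fun A' => A' + solA Hc 0 Cx 0 εC A') ε₄ Hc) (ball (0 : NegSize (L : ℝ) η levB 0 𝔸) Rb) ∧
        MapsTo (chartHB Gc (-(Gc.comp (LJ ρ τc Hc Cx J))) (W80 ρ τc (gaugeU g U) Hc Cx εC J Δπ) 0
            (fun A' => A' + solA Hc 0 Cx 0 εC A') ε₄ Hc) (ball (0 : NegSize (L : ℝ) η levB 0 𝔸) Rb)
            (ball (0 : Space115 (L : ℝ) η lev₀ lev₁ (nabla115 η (gaugeU g U))) R') ∧
        chartHB Gc (-(Gc.comp (LJ ρ τc Hc Cx J))) (W80 ρ τc (gaugeU g U) Hc Cx εC J Δπ) 0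
            (fun A' => A' + solA Hc 0 Cx 0 εC A') ε₄ Hc 0 = 0) := by
  -- §1: the uniform operator letters, T-slot radii and (for any displayed `C₄ a₃ θ̄`) the chart radii
  obtain ⟨ε₃, CH, CG, aC, εC, hε₃, hCH, hCG, haC, hεC, hcontr, hdom, H1⟩ :=
    cur_chart_exists_oneInstance_gaugeOrbit_smallField L m hL φ hMφ hMφ' hφ hφ' τ hτ hCτ (η := η) (lev₀ := lev₀) (levB := levB) lev₁ hlev
      (c₀ := c₀) (c₁ := c₁) ha
  -- the W-slot letter from the bounds (`b := C_H`, `M_D := 2‖η⁻¹‖`, `M_ρ := ‖ρ‖`, `M_τ := ‖τc‖`)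
  obtain ⟨a₃, ha₃, ha₃C, C₄, hC₄, HW⟩ :=
    exists_quadAnalytic_W80_uniform (𝔸 := 𝔸) (Pd := fineP L m) (L := (L : ℝ)) (η := η) (lev₀ := lev₀) (lev₁ := lev₁)
      (𝒳 := NegSize (L : ℝ) η levB 0 𝔸) (C₂ := 2097152 * ((d : ℝ) + 1) ^ 2) (c₄ := 1 / (512 * ((d : ℝ) + 1)))
      (MD := 2 * ‖((η : ℂ))⁻¹‖) hCH.le (by positivity) haC hεC.le hdom hcontr hCV hRV (norm_nonneg ρ) (norm_nonneg τc) hMJ hMΔ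
      (by positivity)
  obtain ⟨ε₄, Rb, R', hε₄, hRb, hR', H2⟩ := H1 hC₄ ha₃ ha₃C hθ0 hθ1
  refine ⟨ε₃, CH, CG, aC, εC, a₃, C₄, ε₄, Rb, R', hε₃, hCH, hCG, haC, hεC, ha₃, hC₄, hε₄, hRb, hR', ?_⟩
  intro U α hα hα1 hU1 hreg hαL ε hε hεε₃ hUε hRS g hg hstar hτg hAd hU1' hreg' hqV J Δπ hJ hΔ
  obtain ⟨hpos, hmain⟩ := H2 U hα hα1 hU1 hreg hαL hε hεε₃ hUε hRS hg hstar hτg hAd hU1' hreg' ρ τc J Δπ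
  refine ⟨hpos, ?_⟩
  intro Hc Gc Cx
  obtain ⟨hH, hG, RC, himp⟩ := hmain
  -- `‖∇_U‖ ≤ 2|η|⁻¹` from the unit-boundedness read off `hU1`
  have hUb : ∀ b : Bond d (fineP L m), ‖((gaugeU g U b : 𝔸ˣ) : 𝔸)‖ ≤ 1 ∧ ‖(((gaugeU g U b)⁻¹ : 𝔸ˣ) : 𝔸)‖ ≤ 1 := fun b => by
    obtain ⟨y, κ⟩ := b
    have h := hU1' (liftSite y) κ
    rw [B9Eq315QTorus.perCfg_apply, perSite_liftSite] at h
    exact B7Prop1Explicit.mem_U1.1 h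
  have hD : ∀ gg : Bond d (fineP L m) → 𝔸, ‖nabla115 η (gaugeU g U) gg‖ ≤ 2 * ‖((η : ℂ))⁻¹‖ * ‖gg‖ := fun gg =>
    norm_nabla115_le η (gaugeU g U) hUb gg
  have hC : Prop4Hyp Cx (2097152 * ((d : ℝ) + 1) ^ 2) (1 / (512 * ((d : ℝ) + 1))) :=
    prop4Hyp_Cc L m η (gaugeU g U) lev₀ lev₁ (nabla115 η (gaugeU g U)) levB hL hα hU1' hreg' hlev
  have hW := HW hD RC hC ρ τc (gaugeU g U) le_rfl le_rfl hqV J Δπ hJ hΔ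
  exact ⟨hH, hG, RC, hW.1, fun hθ => himp hW.1.quad hθ⟩

/-! ## §3 On the orbit, the linear slot's contraction PRODUCED too — no uniform letter displayed -/

set_option maxRecDepth 8192 in
/-- **§3 ON THE GAUGE ORBIT — NOTHING UNIFORM DISPLAYED** (the host's `…_uniform_smallJ` with the conclusion's background `gaugeU g U`): for
`‖J‖₍₋₃₎ ≤ j₁`, `‖Δπ‖ ≤ M_Δ` and every `V = U^g` in the gauge orbit of the small-field set, `hpos′ ∧ QuadAnalytic … ∧ ‖𝔊(U^g) ∘L L_J‖ ≤ ½ ∧ (Ψ1)–(Ψ3)` on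
ONE pair of balls — the display-free consumer face (ne9-leaf-05 g69's remark (r1)). §2 of this file + `exists_norm_LJ_le_uniform`. [folklore] -/
theorem cur_chart_exists_oneInstance_gaugeOrbit_smallField_smallJ {d : ℕ} (L : ℕ) [NeZero L] (m : Fin d → ℕ) [∀ i, NeZero (fineP L m i)]
    (hL : 1 ≤ L)
    {𝔸 : Type*} [NormedRing 𝔸] [NormedAlgebra ℂ 𝔸] [CompleteSpace 𝔸] [NormOneClass 𝔸] [StarRing 𝔸] [NormedStarGroup 𝔸] [StarModule ℂ 𝔸]
    [FiniteDimensional ℂ 𝔸]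
    {W : Type*} [NormedAddCommGroup W] [InnerProductSpace ℂ W] [FiniteDimensional ℂ W] (φ : W ≃ₗ[ℂ] 𝔸) {Mφ Mφ' : ℝ} (hMφ : 0 ≤ Mφ)
    (hMφ' : 0 ≤ Mφ') (hφ : ∀ w, ‖φ w‖ ≤ Mφ * ‖w‖) (hφ' : ∀ X, ‖φ.symm X‖ ≤ Mφ' * ‖X‖)
    (τ : 𝔸 →ₗ[ℂ] ℂ) {Cτ : ℝ} (hτ : ∀ X, ‖τ X‖ ≤ Cτ * ‖X‖) (hCτ : 0 ≤ Cτ)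
    {η : ℝ} [Fact (0 < (L : ℝ))] [Fact (0 < η)] {lev₀ : Bond d (fineP L m) → ℕ} {levB : Bond d m → ℕ} (lev₁ : Bond d (fineP L m) × Fin d → ℕ)
    (hlev : ∀ b, 1 ≤ lev₀ b) {c₀ c₁ : ℝ} [Fact (0 < c₀)] [Fact (0 < c₁)] {a : ℝ} (ha : 0 < a)
    (ρ : (𝔸 →L[ℂ] ℂ) →L[ℂ] 𝔸) (τc : 𝔸 →L[ℂ] ℂ) {CV RV MJ MΔ : ℝ} (hCV : 0 ≤ CV) (hRV : 0 < RV) (hMJ : 0 < MJ) (hMΔ : 0 ≤ MΔ) :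
    ∃ ε₃ aC εC a₃ C₄ ε₄ Rb R' j₁ : ℝ, 0 < ε₃ ∧ 0 < aC ∧ 0 < εC ∧ 0 < a₃ ∧ 0 ≤ C₄ ∧ 0 < ε₄ ∧ 0 < Rb ∧ 0 < R' ∧ 0 < j₁ ∧ j₁ ≤ MJ ∧
      ∀ (U : Bond d (fineP L m) → 𝔸ˣ) {α : ℝ} (hα : α ≤ 1 / 128) (hα1 : α ≤ 1 / 64)
        (hU1 : ∀ (x : B7Prop1Explicit.Site d) (κ : Fin d), perCfg (fineP L m) U x κ ∈ U1 𝔸)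
        (hreg : ∀ (y : TSite d m) (κ : Fin d) (r : Fin d → Fin L),
          ‖((Wcx L (perCfg (fineP L m) U) (cornerSite L y) κ (boxVec L r) : 𝔸ˣ) : 𝔸) - 1‖ ≤ α)
        (hαL : 50 * (d + 1) * α * (L : ℝ) ^ d ≤ 1 / 2) {ε : ℝ}, 0 ≤ ε → ε ≤ ε₃ → (∀ b, ‖(U b : 𝔸) - 1‖ ≤ ε) →
        (∀ (b : Bond d (fineP L m)) (v u : W), inner ℂ (adTransportW φ U b v) u = inner ℂ v (adTransportW φ (fun b => (U b)⁻¹) b u)) →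
      ∀ {g : TSite d (fineP L m) → 𝔸ˣ}, (∀ x, g x ∈ U1 𝔸) → (∀ x, star (g x : 𝔸) = ((g x)⁻¹ : 𝔸ˣ)) →
        (∀ (x : TSite d (fineP L m)) (X : 𝔸), τ (AdA (g x) X) = τ X) →
        (∀ (x : TSite d (fineP L m)) (v v' : W), inner ℂ (AdW φ (g x) v) (AdW φ (g x) v') = inner ℂ v v') →
      ∀ (hU1' : ∀ (x : B7Prop1Explicit.Site d) (κ : Fin d), perCfg (fineP L m) (gaugeU g U) x κ ∈ U1 𝔸)
        (hreg' : ∀ (y : TSite d m) (κ : Fin d) (r : Fin d → Fin L),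
          ‖((Wcx L (perCfg (fineP L m) (gaugeU g U)) (cornerSite L y) κ (boxVec L r) : 𝔸ˣ) : 𝔸) - 1‖ ≤ α),
        (∀ Y : Space115 (L : ℝ) η lev₀ lev₁ (nabla115 η (gaugeU g U)), ‖Y‖ < RV →
          ‖curV0 (lev₁ := lev₁) (Dc := nabla115 η (gaugeU g U)) ρ τc (gaugeU g U) Y‖ ≤ CV * ‖Y‖ ^ 2) →
      ∀ (J : NegSize (L : ℝ) η lev₀ 3 𝔸) (Δπ : Space115 (L : ℝ) η lev₀ lev₁ (nabla115 η (gaugeU g U)) →L[ℂ] NegSize (L : ℝ) η lev₀ 3 𝔸),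
        ‖J‖ ≤ j₁ → ‖Δπ‖ ≤ MΔ →
      ∃ hpos : ∀ x : BondL2K ℂ d (fineP L m) c₀ W, x ≠ 0 →
          0 < RCLike.re (inner ℂ x (laplaceAofBackground L m hL φ (gaugeU g U) hα1 hU1' hreg' τ η (c₀ := c₀) (c₁ := c₁) a x)),
      let Hc := H1LatticeCLM (lev₀ := lev₀) (levB := levB) φ hpos (QtorusW_surjective L m hL (gaugeU g U) hα1 hU1' hreg' hαL φ) lev₁ (nabla115 η (gaugeU g U))
      let Gc := frakGLatticeCLM (lev₀ := lev₀) φ hpos (QtorusW_surjective L m hL (gaugeU g U) hα1 hU1' hreg' hαL φ) lev₁ (nabla115 η (gaugeU g U))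
      let Cx := Cc L m η (gaugeU g U) lev₀ lev₁ (nabla115 η (gaugeU g U)) levB
      QuadAnalytic (W80 ρ τc (gaugeU g U) Hc Cx εC J Δπ) C₄ a₃ ∧ ‖Gc.comp (LJ ρ τc Hc Cx J)‖ ≤ 1 / 2 ∧
      DifferentiableOn ℂ (chartHB Gc (-(Gc.comp (LJ ρ τc Hc Cx J))) (W80 ρ τc (gaugeU g U) Hc Cx εC J Δπ) 0
          (fun A' => A' + solA Hc 0 Cx 0 εC A') ε₄ Hc) (ball (0 : NegSize (L : ℝ) η levB 0 𝔸) Rb) ∧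
      MapsTo (chartHB Gc (-(Gc.comp (LJ ρ τc Hc Cx J))) (W80 ρ τc (gaugeU g U) Hc Cx εC J Δπ) 0
          (fun A' => A' + solA Hc 0 Cx 0 εC A') ε₄ Hc) (ball (0 : NegSize (L : ℝ) η levB 0 𝔸) Rb)
          (ball (0 : Space115 (L : ℝ) η lev₀ lev₁ (nabla115 η (gaugeU g U))) R') ∧
      chartHB Gc (-(Gc.comp (LJ ρ τc Hc Cx J))) (W80 ρ τc (gaugeU g U) Hc Cx εC J Δπ) 0
          (fun A' => A' + solA Hc 0 Cx 0 εC A') ε₄ Hc 0 = 0 := by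
  -- §2 at the contraction `θ̄ := 1/2`
  obtain ⟨ε₃, CH, CG, aC, εC, a₃, C₄, ε₄, Rb, R', hε₃, hCH, hCG, haC, hεC, ha₃, hC₄, hε₄, hRb, hR', H2⟩ :=
    cur_chart_exists_oneInstance_gaugeOrbit_smallField_W80 L m hL φ hMφ hMφ' hφ hφ' τ hτ hCτ (η := η) (lev₀ := lev₀) (levB := levB) lev₁ hlev
      (c₀ := c₀) (c₁ := c₁) ha ρ τc hCV hRV hMJ.le hMΔ (θ := 1 / 2) (by norm_num) (by norm_num)
  -- the linear slot's uniform constant (`b := C_H`, `M_D := 2‖η⁻¹‖`, `M_ρ := ‖ρ‖`, `M_τ := ‖τc‖`)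
  obtain ⟨K, hK0, HK⟩ :=
    exists_norm_LJ_le_uniform (𝔸 := 𝔸) (Pd := fineP L m) (L := (L : ℝ)) (η := η) (lev₀ := lev₀) (lev₁ := lev₁)
      (𝒳 := NegSize (L : ℝ) η levB 0 𝔸) (b := CH) (C₂ := 2097152 * ((d : ℝ) + 1) ^ 2) (c₄ := 1 / (512 * ((d : ℝ) + 1))) (aC := aC)
      (εC := εC) (MD := 2 * ‖((η : ℂ))⁻¹‖) hCH.le (by positivity) haC (norm_nonneg ρ) (norm_nonneg τc) (by positivity)
  have hden : 0 < 2 * (CG * K + 1) := by positivity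
  refine ⟨ε₃, aC, εC, a₃, C₄, ε₄, Rb, R', min MJ (1 / (2 * (CG * K + 1))), hε₃, haC, hεC, ha₃, hC₄, hε₄, hRb, hR',
    lt_min hMJ (by positivity), min_le_left _ _, ?_⟩
  intro U α hα hα1 hU1 hreg hαL ε hε hεε₃ hUε hRS g hg hstar hτg hAd hU1' hreg' hqV J Δπ hJ hΔ
  obtain ⟨hpos, hmain⟩ := H2 U hα hα1 hU1 hreg hαL hε hεε₃ hUε hRS hg hstar hτg hAd hU1' hreg' hqV J Δπ (hJ.trans (min_le_left _ _)) hΔ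
  refine ⟨hpos, ?_⟩
  intro Hc Gc Cx
  obtain ⟨-, hG, RC, hWq, himp⟩ := hmain
  -- `‖∇_U‖ ≤ 2|η|⁻¹`, the Sect. C regime at `C_H` and leaf-03's `Prop4Hyp` (as in §2) feed the `L_J` bound
  have hUb : ∀ b : Bond d (fineP L m), ‖((gaugeU g U b : 𝔸ˣ) : 𝔸)‖ ≤ 1 ∧ ‖(((gaugeU g U b)⁻¹ : 𝔸ˣ) : 𝔸)‖ ≤ 1 := fun b => by
    obtain ⟨y, κ⟩ := b
    have h := hU1' (liftSite y) κ
    rw [B9Eq315QTorus.perCfg_apply, perSite_liftSite] at h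
    exact B7Prop1Explicit.mem_U1.1 h
  have hD : ∀ gg : Bond d (fineP L m) → 𝔸, ‖nabla115 η (gaugeU g U) gg‖ ≤ 2 * ‖((η : ℂ))⁻¹‖ * ‖gg‖ := fun gg =>
    norm_nabla115_le η (gaugeU g U) hUb gg
  have hC : Prop4Hyp Cx (2097152 * ((d : ℝ) + 1) ^ 2) (1 / (512 * ((d : ℝ) + 1))) :=
    prop4Hyp_Cc L m η (gaugeU g U) lev₀ lev₁ (nabla115 η (gaugeU g U)) levB hL hα hU1' hreg' hlev
  have hLJ : ‖LJ ρ τc Hc Cx J‖ ≤ K * ‖J‖ := HK hD RC hC ρ τc le_rfl le_rfl J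
  have hθ : ‖Gc.comp (LJ ρ τc Hc Cx J)‖ ≤ 1 / 2 := by
    have hfrac : CG * K / (2 * (CG * K + 1)) ≤ 1 / 2 := by
      rw [div_le_div_iff₀ hden (by norm_num : (0 : ℝ) < 2)]
      nlinarith [mul_nonneg hCG.le hK0]
    calc ‖Gc.comp (LJ ρ τc Hc Cx J)‖ ≤ ‖Gc‖ * ‖LJ ρ τc Hc Cx J‖ := ContinuousLinearMap.opNorm_comp_le _ _
      _ ≤ CG * (K * ‖J‖) := mul_le_mul hG hLJ (ContinuousLinearMap.opNorm_nonneg _) hCG.le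
      _ ≤ CG * (K * (1 / (2 * (CG * K + 1)))) := by
          have hJ' : ‖J‖ ≤ 1 / (2 * (CG * K + 1)) := hJ.trans (min_le_right _ _)
          exact mul_le_mul_of_nonneg_left (mul_le_mul_of_nonneg_left hJ' hK0) hCG.le
      _ = CG * K / (2 * (CG * K + 1)) := by ring
      _ ≤ 1 / 2 := hfrac
  exact ⟨hWq, hθ, himp hθ⟩

end Summit.QuantumFields.BalabanUV.T4Continuum.NE9CurChartOneInstanceGaugeOrbit

end
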